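import Summits.MatrixMultiplication.OmegaCensus.ThreeSetZpCells4Core
import Summits.MatrixMultiplication.OmegaCensus.ThreeSetZ19Cover456
import Summits.MatrixMultiplication.OmegaCensus.ThreeSetZ19Killers456Join
import HarnessLib

/-!
# The census cell `(4,5,6)@361` is KERNEL: no cube law triple with parts `4, 5, 6` in `Dih(ℤ_19²)`

ω-census `pub-omega`, family (b3), seat pub-omega-group gen 39.  Framing: lottery ticket; floor = certified bounds/negative ranges.
VALUE: a kernel theorem about the group-theoretic method (TPP capacity of dihedral-like groups); NOT progress on ω.  W-level route:
`ThreeSetZpFrame4` / `ThreeSetZpCells4Core` (generic) + `ThreeSetZ19Cover456` (frames) + `ThreeSetZ19Killers456*` (killers).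
-/

namespace Summit.MatrixMultiplication.OmegaCensus

open Finset ZpZpDomino

section DihedralLike

variable {A : Type} [AddCommGroup A] [DecidableEq A] [Fintype A] {G : Type} [Group G] [DecidableEq G]
  {ρ τ : A → G} {c₀ : A} {S T U : Finset G}

open Literature.Combinatorics.Additive

/-- **Cell `(4,5,6)@361` in all orderings** over `|A| = 361`, `A ↠ ℤ_19²` (dihedral-like `G`, any `c₀`). [folklore] -/
theorem no_law_cube_four_5_card361 (hA : Fintype.card A = 361)
    (hρρ : ∀ a b, ρ a * ρ b = ρ (a + b)) (hρτ : ∀ a b, ρ a * τ b = τ (b - a))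
    (hτρ : ∀ a b, τ a * ρ b = τ (a + b)) (hττ : ∀ a b, τ a * τ b = ρ (c₀ + b - a))
    (hρ : Function.Injective ρ) (hτ : Function.Injective τ) (hne : ∀ a b, ρ a ≠ τ b)
    (hsurj : ∀ g, (∃ a, ρ a = g) ∨ (∃ a, τ a = g))
    (Φ : A →+ ZMod 19 × ZMod 19) (hΦ : Function.Surjective Φ)
    (h : TripleProductProperty S T U)
    (hS : (univ.filter fun a : A => ρ a ∈ S).card = (univ.filter fun a : A => τ a ∈ S).card)
    (hT : (univ.filter fun a : A => ρ a ∈ T).card = (univ.filter fun a : A => τ a ∈ T).card)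
    (hU : (univ.filter fun a : A => ρ a ∈ U).card = (univ.filter fun a : A => τ a ∈ U).card)
    (h4d : ((univ.filter fun a : A => ρ a ∈ S).card = 4 ∧ (univ.filter fun a : A => ρ a ∈ T).card = 5) ∨
      ((univ.filter fun a : A => ρ a ∈ T).card = 4 ∧ (univ.filter fun a : A => ρ a ∈ U).card = 5) ∨
      ((univ.filter fun a : A => ρ a ∈ U).card = 4 ∧ (univ.filter fun a : A => ρ a ∈ S).card = 5) ∨
      ((univ.filter fun a : A => ρ a ∈ S).card = 5 ∧ (univ.filter fun a : A => ρ a ∈ T).card = 4) ∨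
      ((univ.filter fun a : A => ρ a ∈ T).card = 5 ∧ (univ.filter fun a : A => ρ a ∈ U).card = 4) ∨
      ((univ.filter fun a : A => ρ a ∈ U).card = 5 ∧ (univ.filter fun a : A => ρ a ∈ S).card = 4)) :
    3 * (S.card * T.card * U.card) + 8 ≠ 8 * Fintype.card A :=
  haveI : Fact (Nat.Prime 19) := ⟨by norm_num⟩
  no_law_cube_four_d_sq_of_killers (p := 19) (by norm_num) (d := 5) (e := 6) (by norm_num) _ Z19Cover456.cover
    Z19Killers456.killers (by rw [hA]) hρρ hρτ hτρ hττ hρ hτ hne hsurj Φ hΦ h hS hT hU h4d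

end DihedralLike

section Instance

variable {G : Type} [Group G] [DecidableEq G] {S T U : Finset G}

open Literature.Combinatorics.Additive

/-- **`Dih(ℤ_19 × ℤ_19)`: no TPP triple with balanced coset parts, a part `4` next to a part `5`, attains the law.** [folklore] -/
theorem no_law_cube_four_5_z19_z19 {ρ τ : ZMod 19 × ZMod 19 → G} {c₀ : ZMod 19 × ZMod 19}
    (hρρ : ∀ a b, ρ a * ρ b = ρ (a + b)) (hρτ : ∀ a b, ρ a * τ b = τ (b - a))
    (hτρ : ∀ a b, τ a * ρ b = τ (a + b)) (hττ : ∀ a b, τ a * τ b = ρ (c₀ + b - a))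
    (hρ : Function.Injective ρ) (hτ : Function.Injective τ) (hne : ∀ a b, ρ a ≠ τ b)
    (hsurj : ∀ g, (∃ a, ρ a = g) ∨ (∃ a, τ a = g))
    (h : TripleProductProperty S T U)
    (hS : (univ.filter fun a : ZMod 19 × ZMod 19 => ρ a ∈ S).card = (univ.filter fun a : ZMod 19 × ZMod 19 => τ a ∈ S).card)
    (hT : (univ.filter fun a : ZMod 19 × ZMod 19 => ρ a ∈ T).card = (univ.filter fun a : ZMod 19 × ZMod 19 => τ a ∈ T).card)
    (hU : (univ.filter fun a : ZMod 19 × ZMod 19 => ρ a ∈ U).card = (univ.filter fun a : ZMod 19 × ZMod 19 => τ a ∈ U).card)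
    (h4d : ((univ.filter fun a : ZMod 19 × ZMod 19 => ρ a ∈ S).card = 4 ∧ (univ.filter fun a : ZMod 19 × ZMod 19 => ρ a ∈ T).card = 5) ∨
      ((univ.filter fun a : ZMod 19 × ZMod 19 => ρ a ∈ T).card = 4 ∧ (univ.filter fun a : ZMod 19 × ZMod 19 => ρ a ∈ U).card = 5) ∨
      ((univ.filter fun a : ZMod 19 × ZMod 19 => ρ a ∈ U).card = 4 ∧ (univ.filter fun a : ZMod 19 × ZMod 19 => ρ a ∈ S).card = 5) ∨
      ((univ.filter fun a : ZMod 19 × ZMod 19 => ρ a ∈ S).card = 5 ∧ (univ.filter fun a : ZMod 19 × ZMod 19 => ρ a ∈ T).card = 4) ∨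
      ((univ.filter fun a : ZMod 19 × ZMod 19 => ρ a ∈ T).card = 5 ∧ (univ.filter fun a : ZMod 19 × ZMod 19 => ρ a ∈ U).card = 4) ∨
      ((univ.filter fun a : ZMod 19 × ZMod 19 => ρ a ∈ U).card = 5 ∧ (univ.filter fun a : ZMod 19 × ZMod 19 => ρ a ∈ S).card = 4)) :
    3 * (S.card * T.card * U.card) + 8 ≠ 8 * Fintype.card (ZMod 19 × ZMod 19) :=
  no_law_cube_four_5_card361 (by simp [Fintype.card_prod, ZMod.card]) hρρ hρτ hτρ hττ hρ hτ hne hsurj (AddMonoidHom.id _)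
    (fun q => ⟨q, rfl⟩) h hS hT hU h4d

end Instance

end Summit.MatrixMultiplication.OmegaCensus
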